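import Summits.BirchSwinnertonDyer.BirchSwinnertonDyer.Theorems.ThetaPartnerAtTwoSignedControlAtTwoPlusKimOfPrintKummer
import Summits.BirchSwinnertonDyer.BirchSwinnertonDyer.Theorems.ThetaPartnerAtTwoSignedControlAtTwoPlusLocalInjOfCyclic
import Summits.BirchSwinnertonDyer.BirchSwinnertonDyer.Theorems.ThetaPartnerAtTwoSignedControlAtTwoStubControlOfEulerCharTwo
import Summits.BirchSwinnertonDyer.BirchSwinnertonDyer.Theorems.ThetaPartnerAtTwoSignedMainConjectureCMTwoUnitZone
import Summits.BirchSwinnertonDyer.BirchSwinnertonDyer.Theorems.ThetaPartnerAtTwoSignedMainConjectureCMTwoRankZeroReductions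
import Summits.BirchSwinnertonDyer.BirchSwinnertonDyer.Theorems.ThetaPartnerAtTwoSignedMainConjectureCMTwoPeriodUnit
import Literature.NumberTheory.EllipticCurves.Kobayashi2003.SignedSelmerModuleFiniteProofs
import HarnessLib

/-!
# Route `ThetaPartnerAtTwo` (TP2), crux K2r0 `SignedMainConjectureCMTwoRankZero` (stmt-BirchSwinnertonDyer-20312),
# line `rankzero` v8: the two "global" research stubs (T2)_A and (K4c)_A are THEOREMS of the `±` LOCAL theory at `2`,
# and in the UNIT ZONE the whole crux at `A` is LOCAL⁺@2 + PUB

HONEST FRAMING (cell `pub/bsd-wall`, W-ALL row 1, lead prover `bsd-wall-tp2-p2` g4). The crux (Pollack–Rubin 2004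
Thm. 7.3 ported to `p = 2` + `μ⁺ = 0`, for CM `A/ℚ` of analytic rank `0`, good supersingular at `2`, `a₂ = 0`) is NOT
in print at `2` and is NOT proved here. Skeleton `rankzero` v7 (fd96cde8) had four research stubs (T2)_A (bottom-layer
signed control: `Sel⁺(A/ℚ_∞)^γ` finite), (K4c)_A (B. D. Kim's control term at `2`), (E)_A (the Eisenstein half
`KobayashiLowerDivisibility A 2 1`, load-bearing) and (μ♭)_A (analytic `μ = 0`). THIS FILE (route-independent: no
`Theses` module is imported) shows, in the kernel:

* §1 `finite_selmerGroupPInfty_two_of_analyticRank_eq_zero` — GZK (PUB) ⇒ `Sel_{2^∞}(A/ℚ)` finite at analytic rank `0`.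
* §2 `signedEulerCharTwo_at_of_local` — (EC2)_A, B. D. Kim's signed `Γ`-Euler characteristic at `2` for ONE curve
  (any `A`, good supersingular at `2`; CM plays no role), from the THREE LOCAL statements of the sibling crux K4
  `SignedControlAtTwo` (line `eulerchar` v5, registered stubs read for `A`): CYC⁺@2 (Kobayashi Prop. 8.12 i) at `2`:
  `E⁺(ℚ_{2,n}·ℚ₂)` monogenic over `ℤ[Γ_{ℚ₂}]` mod `2`), LEV0@2 (`E(ℚ₂) ⊄ 2E(ℚ₂)`), LOC⁺@2 (Greenberg's Lemma 4.7
  surjectivity for the signed quotient, level-`∞` Kummer form) + the five PRINTED Greenberg facts + `Sel` finite — by the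
  landed CM-agnostic doors `SignedEC.plusLocalInj_two_of_cyclicModTwo` (seat tp2-p3-w3) and
  `SignedEC.signedEulerChar_two_of_localInj_of_print_of_kummerLoc` (seat tp2-p3-w2).
* §3 `finiteTorsion_at_of_signedEulerCharTwo`, `kimControl_at_of_signedEulerCharTwo` — (T2)_A (finite `γ`-invariants AND
  `Λ`-torsion at EVERY cyclotomic top-generator pair, `isTorsion_of_finite_endInvariants`) and (K4c)_A (H4 =
  `…EulerChar.stub_controlOfEulerCharTwo`, landed p566400) from (EC2)_A. So (T2)_A and (K4c)_A are no longer research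
  stubs of K2r0: they are the SAME local `±` theory at `2` the K4 line hinges on, read for `A`.
* §4 `unitZone_of_not_two_dvd_shaOrder_mul_tamagawaProduct` — for CM `A` of analytic rank `0` (BSD₂(A) IN PRINT:
  Burungale–Flach 2024; GZK; the `p = 2` period fact): `2 ∤ #Ш(A)·∏c_ℓ(A)` ⇒ for every newform `f` of `A` and period
  ratio `ϖ`, `ord₂ ϖ = 0` and `ord₂ [0]⁺_f = 0` (the unit-zone hypothesis of `signedMainConjectureCMTwo_pointwise_of_unitZone`).
* §5 `signedMainConjectureCMTwoRankZero_at_unitZone_of_local` — **in the unit zone `2 ∤ #Ш(A)·∏c_ℓ(A)` BOTH conjuncts of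
  the crux hold AT `A` from LOCAL⁺@2(A) + PUB alone** (no elliptic units, no two-variable main conjecture, no
  `μ`-conjecture): `char X⁺ = Λ`, `μ⁺ = 0`, `KobayashiMainConjecture A 2 1` with unit generator `ϖ·L♭`.
* §6 `signedMainConjectureCMTwoRankZero_at_of_local` — for every `A` on the row: LOCAL⁺@2(A) + PUB + (E)_A + (μ♭)_A ⇒
  both conjuncts at `A` (v7's composition `signedMainConjectureCMTwo_at_rankZero_of_lowerDivisibility` (p518019) +
  signed generator change (p526353), fed by §3).
Nothing about any curve is asserted; every research input is a displayed binder; BSD is not proved by any of this.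

References: [Kobayashi2003] Def. 1.1, Thm. 1.2, Prop. 8.12, Thm. 9.3; [BDKim2013] Cor. 3.15, Props. 2.2–2.3;
[GreenbergLNM1716] §4 Lemma 4.2, Lemma 4.7, Props. 4.12–4.13, §5; [BurungaleFlach2024] Thm. 1.1; [PollackRubin2004]
Thm. 7.3 (p > 2); [Sprung2017] Thm. 1.12; [Washington1997] §13.2; [Miller2011LMS] Def. 1.1.
-/

set_option autoImplicit false
-- the Theorems namespace of this sub repeats the summit name by design (D-0017 nested layout)
set_option linter.dupNamespace false

noncomputable section

open scoped Classical NumberField MatrixGroups ModularForm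

open NumberField IsDedekindDomain CongruenceSubgroup

namespace Summit.BirchSwinnertonDyer.BirchSwinnertonDyer.Theorems

open Literature.NumberTheory.EllipticCurves Literature.NumberTheory.GaloisRepresentations
  WeierstrassCurve ZpExtension Literature.NumberTheory.EllipticCurves.Kobayashi2003
  Literature.NumberTheory.EllipticCurves.IwasawaDual Literature.NumberTheory.EllipticCurves.GreenbergVatsal2000
  Literature.NumberTheory.EllipticCurves.ModularForms Literature.NumberTheory.EllipticCurves.Rank1Residual
  Literature.NumberTheory.EllipticCurves.Rank1Residual.Typed
  Summit.BirchSwinnertonDyer.Rank1Residual Summit.BirchSwinnertonDyer.Rank1Residual.Supersingular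

variable (A : WeierstrassCurve ℚ) [A.IsElliptic] [A.IsGloballyMinimal]

/-! ## §1. `Sel_{2^∞}(A/ℚ)` finite at analytic rank `0` (GZK) -/

omit [A.IsGloballyMinimal] in
/-- At analytic rank `0`, Gross–Zagier–Kolyvagin (`hGZK`, PUB: rank `0` and `Ш` finite) makes
`Sel_{2^∞}(A/ℚ)` finite: `#Sel_{2^∞}(A/ℚ) = #Ш[2^∞]` (`natCard_selmerGroupPInfty_eq_natCard_primaryComponent_sha`).
[cite: Kolyvagin1990, Thm. A] [cite: GrossZagier1986, Thm. I.6.3] -/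
theorem finite_selmerGroupPInfty_two_of_analyticRank_eq_zero
    (hGZK : rank_eq_analyticRank_of_analyticRank_le_one) (hr : A.analyticRank = 0) :
    Finite (A.selmerGroupPInfty 2) := by
  have hr0 : A.mordellWeilRank = 0 := (hGZK A (by omega)).1.trans hr
  haveI : Finite A.toAffine.Point := A.mordellWeilRank_eq_zero_iff_finite.mp hr0
  haveI : Finite A.sha := (hGZK A (by omega)).2
  have hSel : Nat.card (A.selmerGroupPInfty 2) = Nat.card (AddCommGroup.primaryComponent A.sha 2) :=
    A.natCard_selmerGroupPInfty_eq_natCard_primaryComponent_sha 2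
  exact Nat.finite_of_card_ne_zero (by rw [hSel]; exact Nat.card_pos.ne')

/-! ## §2. (EC2)_A from the three local statements at `2` + Greenberg's printed facts -/

/-- **(EC2) at one curve from LOCAL⁺@2 + PRINT.** `A/ℚ` globally minimal, good supersingular at `2` (no CM
hypothesis, no rank hypothesis), `κ` the cyclotomic `ℤ₂`-extension, `γ` a topological generator. ASSUME, at the
place `v ∋ 2`: (LEV0@2) a point of `E(ℚ_v)` not `2`-divisible in `E(ℚ_v)`; (CYC⁺@2) for every `n`, Kobayashi's
`E⁺(ℚ_{2,n}·ℚ_v)` is monogenic over `ℤ[Γ_{ℚ_v}]` modulo `2`; (LOC⁺@2) Greenberg's Lemma 4.7 local surjectivity for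
the signed quotient in the level-`∞` Kummer form; the five printed facts of Greenberg LNM 1716 (Cassels surjectivity,
Prop. 4.12, the corank bound, p. 108, weak Leopoldt); and `Sel_{2^∞}(A/ℚ)` finite. THEN `Sel⁺(A/ℚ_∞)^γ` is finite
and `#Sel⁺_∞^γ = u·2^{v₂∏c_ℓ}·#Sel_{2^∞}(A/ℚ)·#(Sel⁺_∞)_γ` — the doors `SignedEC.plusLocalInj_two_of_cyclicModTwo`
and `SignedEC.signedEulerChar_two_of_localInj_of_print_of_kummerLoc` with `Σ₀` the bad places of `A`.
[cite: BDKim2013, Cor. 3.15 (p. 199)] [cite: GreenbergLNM1716, §4 Lemma 4.7, Props. 4.12–4.13, §5 p. 140]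
[cite: Kobayashi2003, Prop. 8.12, Thm. 9.3 (odd p)] -/
theorem signedEulerCharTwo_at_of_local (hss : GoodSS A 2) {κ : ZpExtension ℚ 2} (hκ : κ.IsCyclotomic)
    {γ : Field.absoluteGaloisGroup ℚ} (hγ : κ.IsTopGenerator γ)
    (hlev : ∀ (v : HeightOneSpectrum (𝓞 ℚ)), (2 : 𝓞 ℚ) ∈ v.asIdeal →
      ∃ m₀ ∈ localLayerPointsOfEmb κ (closureEmb (K := ℚ) (v.adicCompletion ℚ)) A 0,
        ∀ b ∈ localLayerPointsOfEmb κ (closureEmb (K := ℚ) (v.adicCompletion ℚ)) A 0, m₀ ≠ 2 • b)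
    (hcyc : ∀ (v : HeightOneSpectrum (𝓞 ℚ)), (2 : 𝓞 ℚ) ∈ v.asIdeal →
      ∀ n : ℕ, ∃ d ∈ signedLocalPoints κ (v.adicCompletion ℚ) A 1 n,
        ∀ x ∈ signedLocalPoints κ (v.adicCompletion ℚ) A 1 n,
        ∃ B ∈ AddSubgroup.closure (Set.range fun σ : Field.absoluteGaloisGroup (v.adicCompletion ℚ) ↦ σ • d),
          ∃ b ∈ signedLocalPoints κ (v.adicCompletion ℚ) A 1 n, x = B + 2 • b)
    (hlocK : ∀ t : A.subgroupH1 2 κ.kerSubgroup,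
      (∀ σ : Field.absoluteGaloisGroup ℚ, A.conjH1 2 κ.kerSubgroup σ t - t ∈ signedSelmerInfty A κ 1) →
      ∀ w : HeightOneSpectrum (𝓞 ℚ), ((2 : ℕ) : 𝓞 ℚ) ∈ w.asIdeal →
      ∃ xw : discreteH1 (localSubgroup (⊤ : Subgroup (Field.absoluteGaloisGroup ℚ)) (w.adicCompletion ℚ))
          (localPoints A (w.adicCompletion ℚ)),
        (∃ k : ℕ, 2 ^ k • xw = 0) ∧
        ∀ y : A.subgroupH1 2 (⊤ : Subgroup (Field.absoluteGaloisGroup ℚ)),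
          A.localResOver 2 ⊤ (w.adicCompletion ℚ) y = xw →
          t - A.resOfLe 2 (le_top : κ.kerSubgroup ≤ ⊤) y ∈
            localKummerOverOfEmb A 2 κ.kerSubgroup (closureEmb (K := ℚ) (w.adicCompletion ℚ))
              (⨆ n, signedLocalPoints κ (w.adicCompletion ℚ) A 1 n))
    (hC : Greenberg1999.casselsSurjectivity_H1Sigma ℚ)
    (h412 : Greenberg1999.prop412_noFiniteSubmodule_H1Sigma_of_rank_one)
    (hcork : Greenberg1999.h1Sigma_zpCorank_le_degree ℚ)
    (hP108 : Greenberg1999.localQuotient_restriction_surjective ℚ)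
    (hWL : Greenberg1999.h1SigmaInfty_rank_eq_one)
    (hSel : Finite (A.selmerGroupPInfty 2)) :
    Finite (endInvariants (conjSignedSelmerInfty A κ 1 γ - 1)) ∧
      ∃ u : ℤ_[2]ˣ, (Nat.card (endInvariants (conjSignedSelmerInfty A κ 1 γ - 1)) : ℚ_[2]) =
        ((u : ℤ_[2]) : ℚ_[2]) * ((2 : ℕ) : ℚ_[2]) ^ (padicValNat 2 A.tamagawaProduct) *
          (Nat.card (A.selmerGroupPInfty 2) : ℚ_[2]) *
            (Nat.card (EndCoinvariants (conjSignedSelmerInfty A κ 1 γ - 1)) : ℚ_[2]) := by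
  -- `Σ₀` := the (finite) set of bad places of `A`
  have hbad : (A.badPlaces (𝓞 ℚ)).Finite := A.finite_badPlaces_holds (𝓞 ℚ)
  have hgood : ∀ w : HeightOneSpectrum (𝓞 ℚ), w ∉ hbad.toFinset → ((2 : ℕ) : 𝓞 ℚ) ∉ w.asIdeal →
      A.HasGoodReductionAt w := by
    intro w hw _
    by_contra hng
    exact hw (hbad.mem_toFinset.mpr hng)
  exact SignedEC.signedEulerChar_two_of_localInj_of_print_of_kummerLoc A κ hss hκ hγ hbad.toFinset hgood
    (fun v hv ↦ SignedEC.plusLocalInj_two_of_cyclicModTwo A hss κ v hv (hlev v hv) (hcyc v hv))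
    hC h412 hcork hP108 hWL (fun t _ ht w hw ↦ hlocK t ht w hw) hSel

/-! ## §3. (T2)_A and (K4c)_A from (EC2)_A -/

section FromEulerChar

variable {A}

omit [A.IsGloballyMinimal] in
/-- **(T2)_A from (EC2)_A**: if for every cyclotomic top-generator pair the signed Euler characteristic package holds
whenever `Sel_{2^∞}(A/ℚ)` is finite, and `Sel_{2^∞}(A/ℚ)` IS finite, then every Pontryagin-dual datum of
`Sel⁺(A/ℚ_∞)` is finitely generated (`SignedSelmerDualData.moduleFinite`, landed) and `Λ`-torsion
(`isTorsion_of_finite_endInvariants`: `Sel⁺_∞^γ` finite). [cite: Kobayashi2003, Thm. 1.2 (the statement at odd p)]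
[cite: GreenbergLNM1716, §4 Lemma 4.2 (p. 102)] -/
theorem finiteTorsion_at_of_signedEulerCharTwo
    (hEC : ∀ (κ : ZpExtension ℚ 2) (γ : Field.absoluteGaloisGroup ℚ),
      κ.IsCyclotomic → κ.IsTopGenerator γ → Finite (A.selmerGroupPInfty 2) →
      Finite (endInvariants (conjSignedSelmerInfty A κ 1 γ - 1)) ∧
        ∃ u : ℤ_[2]ˣ, (Nat.card (endInvariants (conjSignedSelmerInfty A κ 1 γ - 1)) : ℚ_[2]) =
          ((u : ℤ_[2]) : ℚ_[2]) * ((2 : ℕ) : ℚ_[2]) ^ (padicValNat 2 A.tamagawaProduct) *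
            (Nat.card (A.selmerGroupPInfty 2) : ℚ_[2]) *
              (Nat.card (EndCoinvariants (conjSignedSelmerInfty A κ 1 γ - 1)) : ℚ_[2]))
    (hSel : Finite (A.selmerGroupPInfty 2)) :
    ∀ (κ : ZpExtension ℚ 2) (γ : Field.absoluteGaloisGroup ℚ), κ.IsCyclotomic → κ.IsTopGenerator γ →
      ∀ D : SignedSelmerDualData A κ γ 1,
        Module.Finite (IwasawaAlgebra 2) D.X ∧ Module.IsTorsion (IwasawaAlgebra 2) D.X :=
  fun κ γ hκ hγ D ↦
    ⟨SignedSelmerDualData.moduleFinite hγ D, D.isTorsion_of_finite_endInvariants hγ (hEC κ γ hκ hγ hSel).1⟩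

/-- **(K4c)_A from (EC2)_A**: B. D. Kim's control term at `2` for `A` — VERBATIM the `hKim` binder of the rank-zero
rigidity file (p518019) and conjunct 2 of crux K4 read for `A` — via H4 (`…EulerChar.stub_controlOfEulerCharTwo`,
Greenberg's Lemma 4.2 on the signed dual pair). [cite: BDKim2013, Cor. 3.15 (p. 199)]
[cite: GreenbergLNM1716, §4 Lemma 4.2 (p. 102)] -/
theorem kimControl_at_of_signedEulerCharTwo
    (hEC : ∀ (κ : ZpExtension ℚ 2) (γ : Field.absoluteGaloisGroup ℚ),
      κ.IsCyclotomic → κ.IsTopGenerator γ → Finite (A.selmerGroupPInfty 2) →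
      Finite (endInvariants (conjSignedSelmerInfty A κ 1 γ - 1)) ∧
        ∃ u : ℤ_[2]ˣ, (Nat.card (endInvariants (conjSignedSelmerInfty A κ 1 γ - 1)) : ℚ_[2]) =
          ((u : ℤ_[2]) : ℚ_[2]) * ((2 : ℕ) : ℚ_[2]) ^ (padicValNat 2 A.tamagawaProduct) *
            (Nat.card (A.selmerGroupPInfty 2) : ℚ_[2]) *
              (Nat.card (EndCoinvariants (conjSignedSelmerInfty A κ 1 γ - 1)) : ℚ_[2])) :
    ∀ (κ : ZpExtension ℚ 2) (γ : Field.absoluteGaloisGroup ℚ), κ.IsCyclotomic → κ.IsTopGenerator γ →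
      ∀ (D : SignedSelmerDualData A κ γ 1) [Module.Finite (IwasawaAlgebra 2) D.X],
        Module.IsTorsion (IwasawaAlgebra 2) D.X →
      ∀ g : IwasawaAlgebra 2, D.charIdeal = Ideal.span {g} → Finite (A.selmerGroupPInfty 2) →
        ∃ u : ℤ_[2]ˣ, ((PowerSeries.constantCoeff g : ℤ_[2]) : ℚ_[2]) =
          ((u : ℤ_[2]) : ℚ_[2]) * ((2 : ℕ) : ℚ_[2]) ^ (padicValNat 2 A.tamagawaProduct) *
            (Nat.card (A.selmerGroupPInfty 2) : ℚ_[2]) :=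
  fun κ γ hκ hγ D _ hX g hg hSel ↦
    Summit.BirchSwinnertonDyer.BirchSwinnertonDyer.Cruxes.SignedControlAtTwo.EulerChar.stub_controlOfEulerCharTwo
      A κ γ hγ D hX g hg hSel (hEC κ γ hκ hγ hSel)

end FromEulerChar

/-! ## §4. The unit zone `2 ∤ #Ш(A)·∏c_ℓ(A)` in the typed conjecture's vocabulary -/

/-- **`2 ∤ #Ш(A)·∏c_ℓ(A)` ⇒ unit zone.** For a CM curve `A` of analytic rank `0`, good supersingular at `2`:
granted Burungale–Flach (`hBF`: BSD₂(A)), the entire continuation (`hLrat`), GZK (`hGZK`) and the `p = 2` period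
fact (`h2`: `ord₂ ϖ = 0`), if `2 ∤ #Ш(A)·∏c_ℓ(A)` then for every newform `f` of `A` with period ratio `ϖ`
(`ϖ·Ω_A = Ω⁺_f`): `ord₂ ϖ = 0` and `ord₂ [0]⁺_f = 0` (`t = ϖ·[0]⁺_f = L(A,1)/Ω_A = #Ш·∏c_ℓ/#tors²` with
`2 ∤ #tors`, `P2.irr_two_of_goodSS_two`). [cite: BurungaleFlach2024, Thm. 1.1] [cite: Miller2011LMS, Def. 1.1] -/
theorem unitZone_of_not_two_dvd_shaOrder_mul_tamagawaProduct
    (hBF : bsdTriple_of_hasCM_of_L_one_ne_zero) (hLrat : hasEntireLFunction_rat)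
    (hGZK : rank_eq_analyticRank_of_analyticRank_le_one)
    (h2 : Literature.NumberTheory.EllipticCurves.realPeriodRat_eq_unit_mul_plusPeriod_two)
    (hcm : A.HasCM) (hr : A.analyticRank = 0) (hss : GoodSS A 2)
    (hunit : ¬ 2 ∣ A.shaOrder * A.tamagawaProduct) :
    ∀ [NeZero (A.conductorNorm ℤ)] (f : CuspForm (Gamma0 (A.conductorNorm ℤ)) 2),
      IsNewformOf A f → ∀ (ϖ : ℚ), (ϖ : ℝ) * A.realPeriodRat = plusPeriod f →
        padicValRat 2 ϖ = 0 ∧ padicValRat 2 (ratPlusSymbol f 0) = 0 := by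
  intro _ f hf ϖ hϖ
  have hϖ1 : padicValRat 2 ϖ = 0 := padicValRat_periodRatio_eq_zero_two A h2 hss hf hϖ
  refine ⟨hϖ1, ?_⟩
  have hL : A.entireLFunction 1 ≠ 0 := (A.analyticRank_eq_zero_iff_holds (hLrat A)).mp hr
  have hirr : A.HasIrreducibleModPGaloisRep 2 := P2.irr_two_of_goodSS_two A hss
  have hΩpos : 0 < A.realPeriodRat := A.realPeriodRat_pos_holds
  -- `t = ϖ · [0]⁺_f = L(A,1)/Ω_A`
  set s : ℚ := ratPlusSymbol f 0 with hs_def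
  set t : ℚ := ϖ * s with ht_def
  have hLval : A.entireLFunction 1 = (((s : ℝ) * plusPeriod f : ℝ) : ℂ) := hf.entireLFunction_one_eq
  have ht : A.entireLFunction 1 / (A.realPeriodRat : ℂ) = ((t : ℚ) : ℂ) := by
    rw [hLval, ← hϖ, div_eq_iff (Complex.ofReal_ne_zero.mpr hΩpos.ne'), ht_def]
    push_cast
    ring
  have hs0 : s ≠ 0 := by
    intro h0
    apply hL
    rw [hLval, h0]
    simp
  have hϖ0 : ϖ ≠ 0 := by
    rintro rfl
    apply hL
    have h : plusPeriod f = 0 := by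
      have h := hϖ
      simp only [Rat.cast_zero, zero_mul] at h
      exact h.symm
    rw [hLval, h]
    simp
  have ht0 : t ≠ 0 := mul_ne_zero hϖ0 hs0
  -- BSD₂(A) (Burungale–Flach): `ord₂ #Ш_an = ord₂ #Ш`, `#Ш_an = t·#tors²/∏c_ℓ`
  have hBSD : BSDp A 2 :=
    forall_bsdp_of_bsdTriple A A.tamagawaProduct_pos_holds (hBF A hcm hL) 2 Nat.prime_two
  haveI : Finite A.sha := (hGZK A (by omega)).2
  obtain ⟨q, hq, hv⟩ := missingPPartAt_of_bsdp A 2 hBSD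
  have hsha := shaAn_eq_of_analyticRank_eq_zero A hGZK hr ht
  have hqt : q = t * (A.torsionOrder : ℚ) ^ 2 / (A.tamagawaProduct : ℚ) := by
    have h := hq.symm.trans hsha
    exact_mod_cast h
  rw [hqt, padicValRat_shaAn_witness A 2 hirr ht0] at hv
  -- `2 ∤ #Ш · ∏c_ℓ`
  have hsha0 : A.shaOrder ≠ 0 := by
    rw [WeierstrassCurve.shaOrder]; exact Nat.card_pos.ne'
  have htam0 : A.tamagawaProduct ≠ 0 := A.tamagawaProduct_pos'.ne'
  have hvS : padicValNat 2 A.shaOrder = 0 :=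
    padicValNat.eq_zero_of_not_dvd fun h ↦ hunit (dvd_mul_of_dvd_left h _)
  have hvT : padicValNat 2 A.tamagawaProduct = 0 :=
    padicValNat.eq_zero_of_not_dvd fun h ↦ hunit (dvd_mul_of_dvd_right h _)
  rw [hvS, hvT] at hv
  have hvt : padicValRat 2 t = 0 := by
    push_cast at hv
    linarith
  rw [ht_def, padicValRat.mul hϖ0 hs0, hϖ1, zero_add] at hvt
  exact hvt

/-! ## §5. The crux AT a unit-zone curve from LOCAL⁺@2 + PUB -/

/-- **K2r0 AT a unit-zone CM curve is LOCAL⁺@2 + PUB.** Let `A/ℚ` be CM, globally minimal, of analytic rank `0`,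
good supersingular at `2` with `a₂ = 0`, and in the UNIT ZONE `2 ∤ #Ш(A)·∏c_ℓ(A)`. Grant the published inputs BY
NAME — Burungale–Flach 2024 (`hBF`), modularity (`hmod`, `hLrat`), GZK (`hGZK`), the `p = 2` period fact (`h2`), the
five Greenberg facts (`hC h412 hcork hP108 hWL`) — and the three LOCAL `±` statements at `2` READ FOR `A` (CYC⁺@2,
LEV0@2, LOC⁺@2: the registered stubs of K4's line `eulerchar` v5 with `A` for `W`). THEN both conjuncts of crux K2r0
hold AT `A`: every dual datum of `Sel⁺(A/ℚ_∞)` at every cyclotomic top-generator pair is `Λ`-torsion with `μ⁺ = 0`,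
and `KobayashiMainConjecture A 2 1` (with `char X⁺ = Λ = (ϖ·L♭)`). No elliptic units, no two-variable main
conjecture, no analytic `μ`-input: (T2)_A and (K4c)_A come from §§2–3 and the rest is
`signedMainConjectureCMTwo_pointwise_of_unitZone`. [cite: BurungaleFlach2024, Thm. 1.1]
[cite: Kobayashi2003, Thm. 1.2, Conjecture (p. 2)] [cite: BDKim2013, Cor. 3.15] [cite: GreenbergLNM1716, §4] -/
theorem signedMainConjectureCMTwoRankZero_at_unitZone_of_local
    (hBF : bsdTriple_of_hasCM_of_L_one_ne_zero)
    (hmod : nonempty_modularParametrizationData) (hLrat : hasEntireLFunction_rat)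
    (hGZK : rank_eq_analyticRank_of_analyticRank_le_one)
    (h2 : Literature.NumberTheory.EllipticCurves.realPeriodRat_eq_unit_mul_plusPeriod_two)
    (hC : Greenberg1999.casselsSurjectivity_H1Sigma ℚ)
    (h412 : Greenberg1999.prop412_noFiniteSubmodule_H1Sigma_of_rank_one)
    (hcork : Greenberg1999.h1Sigma_zpCorank_le_degree ℚ)
    (hP108 : Greenberg1999.localQuotient_restriction_surjective ℚ)
    (hWL : Greenberg1999.h1SigmaInfty_rank_eq_one)
    (hcm : A.HasCM) (hr : A.analyticRank = 0) (hss : GoodSS A 2) (ha : A.frobeniusTrace 2 = 0)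
    (hunit : ¬ 2 ∣ A.shaOrder * A.tamagawaProduct)
    (hlev : ∀ (κ : ZpExtension ℚ 2), κ.IsCyclotomic →
      ∀ (v : HeightOneSpectrum (𝓞 ℚ)), (2 : 𝓞 ℚ) ∈ v.asIdeal →
      ∃ m₀ ∈ localLayerPointsOfEmb κ (closureEmb (K := ℚ) (v.adicCompletion ℚ)) A 0,
        ∀ b ∈ localLayerPointsOfEmb κ (closureEmb (K := ℚ) (v.adicCompletion ℚ)) A 0, m₀ ≠ 2 • b)
    (hcyc : ∀ (κ : ZpExtension ℚ 2), κ.IsCyclotomic →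
      ∀ (v : HeightOneSpectrum (𝓞 ℚ)), (2 : 𝓞 ℚ) ∈ v.asIdeal →
      ∀ n : ℕ, ∃ d ∈ signedLocalPoints κ (v.adicCompletion ℚ) A 1 n,
        ∀ x ∈ signedLocalPoints κ (v.adicCompletion ℚ) A 1 n,
        ∃ B ∈ AddSubgroup.closure (Set.range fun σ : Field.absoluteGaloisGroup (v.adicCompletion ℚ) ↦ σ • d),
          ∃ b ∈ signedLocalPoints κ (v.adicCompletion ℚ) A 1 n, x = B + 2 • b)
    (hlocK : ∀ (κ : ZpExtension ℚ 2), κ.IsCyclotomic →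
      ∀ t : A.subgroupH1 2 κ.kerSubgroup,
        (∀ σ : Field.absoluteGaloisGroup ℚ, A.conjH1 2 κ.kerSubgroup σ t - t ∈ signedSelmerInfty A κ 1) →
        ∀ w : HeightOneSpectrum (𝓞 ℚ), ((2 : ℕ) : 𝓞 ℚ) ∈ w.asIdeal →
        ∃ xw : discreteH1 (localSubgroup (⊤ : Subgroup (Field.absoluteGaloisGroup ℚ)) (w.adicCompletion ℚ))
            (localPoints A (w.adicCompletion ℚ)),
          (∃ k : ℕ, 2 ^ k • xw = 0) ∧
          ∀ y : A.subgroupH1 2 (⊤ : Subgroup (Field.absoluteGaloisGroup ℚ)),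
            A.localResOver 2 ⊤ (w.adicCompletion ℚ) y = xw →
            t - A.resOfLe 2 (le_top : κ.kerSubgroup ≤ ⊤) y ∈
              localKummerOverOfEmb A 2 κ.kerSubgroup (closureEmb (K := ℚ) (w.adicCompletion ℚ))
                (⨆ n, signedLocalPoints κ (w.adicCompletion ℚ) A 1 n)) :
    (∀ (κ : ZpExtension ℚ 2) (γ : Field.absoluteGaloisGroup ℚ), κ.IsCyclotomic → κ.IsTopGenerator γ →
      ∀ D : SignedSelmerDualData A κ γ 1, Module.IsTorsion (IwasawaAlgebra 2) D.X ∧ D.mu = 0) ∧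
    KobayashiMainConjecture A 2 1 := by
  have hL : A.entireLFunction 1 ≠ 0 := (A.analyticRank_eq_zero_iff_holds (hLrat A)).mp hr
  have hSel : Finite (A.selmerGroupPInfty 2) := finite_selmerGroupPInfty_two_of_analyticRank_eq_zero A hGZK hr
  have hEC := fun (κ : ZpExtension ℚ 2) (γ : Field.absoluteGaloisGroup ℚ) (hκ : κ.IsCyclotomic)
      (hγ : κ.IsTopGenerator γ) (hSel' : Finite (A.selmerGroupPInfty 2)) ↦
    signedEulerCharTwo_at_of_local A hss hκ hγ (hlev κ hκ) (hcyc κ hκ) (hlocK κ hκ) hC h412 hcork hP108 hWL hSel'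
  exact signedMainConjectureCMTwo_pointwise_of_unitZone A hBF hmod hGZK hcm hss ha hL
    (finiteTorsion_at_of_signedEulerCharTwo hEC hSel) (kimControl_at_of_signedEulerCharTwo hEC)
    (unitZone_of_not_two_dvd_shaOrder_mul_tamagawaProduct A hBF hLrat hGZK h2 hcm hr hss hunit)

/-! ## §6. The crux AT any curve of the row from LOCAL⁺@2 + PUB + (E)_A + (μ♭)_A -/

/-- **K2r0 AT `A` from LOCAL⁺@2 + PUB + the Eisenstein half + analytic `μ = 0`.** Same `A` and PUB as in
`signedMainConjectureCMTwoRankZero_at_unitZone_of_local`, no zone hypothesis; the three local statements at `2` read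
for `A`; and the two research binders that carry the Iwasawa theory of elliptic units at the inert prime `2`:
(E)_A `KobayashiLowerDivisibility A 2 1` and (μ♭)_A (`L♭_A` has a unit coefficient for every newform/Pollack-pair
datum). THEN both conjuncts of the crux hold AT `A`: (T2)_A, (K4c)_A from §3, the rank-zero rigidity
`signedMainConjectureCMTwo_at_rankZero_of_lowerDivisibility` (p518019) at the normalised pairs, and signed generator
change (`stub_generatorChangeCMTwo`, p526353) for `μ⁺ = 0` at every pair. [cite: PollackRubin2004, Thm. 7.3 (p > 2)]
[cite: Kobayashi2003, Thm. 1.2, Conjecture (p. 2)] [cite: BDKim2013, Cor. 3.15] [cite: BurungaleFlach2024, Thm. 1.1] -/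
theorem signedMainConjectureCMTwoRankZero_at_of_local
    (hBF : bsdTriple_of_hasCM_of_L_one_ne_zero)
    (hmod : nonempty_modularParametrizationData) (hLrat : hasEntireLFunction_rat)
    (hGZK : rank_eq_analyticRank_of_analyticRank_le_one)
    (h2 : Literature.NumberTheory.EllipticCurves.realPeriodRat_eq_unit_mul_plusPeriod_two)
    (hC : Greenberg1999.casselsSurjectivity_H1Sigma ℚ)
    (h412 : Greenberg1999.prop412_noFiniteSubmodule_H1Sigma_of_rank_one)
    (hcork : Greenberg1999.h1Sigma_zpCorank_le_degree ℚ)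
    (hP108 : Greenberg1999.localQuotient_restriction_surjective ℚ)
    (hWL : Greenberg1999.h1SigmaInfty_rank_eq_one)
    (hcm : A.HasCM) (hr : A.analyticRank = 0) (hss : GoodSS A 2) (ha : A.frobeniusTrace 2 = 0)
    (hlev : ∀ (κ : ZpExtension ℚ 2), κ.IsCyclotomic →
      ∀ (v : HeightOneSpectrum (𝓞 ℚ)), (2 : 𝓞 ℚ) ∈ v.asIdeal →
      ∃ m₀ ∈ localLayerPointsOfEmb κ (closureEmb (K := ℚ) (v.adicCompletion ℚ)) A 0,
        ∀ b ∈ localLayerPointsOfEmb κ (closureEmb (K := ℚ) (v.adicCompletion ℚ)) A 0, m₀ ≠ 2 • b)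
    (hcyc : ∀ (κ : ZpExtension ℚ 2), κ.IsCyclotomic →
      ∀ (v : HeightOneSpectrum (𝓞 ℚ)), (2 : 𝓞 ℚ) ∈ v.asIdeal →
      ∀ n : ℕ, ∃ d ∈ signedLocalPoints κ (v.adicCompletion ℚ) A 1 n,
        ∀ x ∈ signedLocalPoints κ (v.adicCompletion ℚ) A 1 n,
        ∃ B ∈ AddSubgroup.closure (Set.range fun σ : Field.absoluteGaloisGroup (v.adicCompletion ℚ) ↦ σ • d),
          ∃ b ∈ signedLocalPoints κ (v.adicCompletion ℚ) A 1 n, x = B + 2 • b)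
    (hlocK : ∀ (κ : ZpExtension ℚ 2), κ.IsCyclotomic →
      ∀ t : A.subgroupH1 2 κ.kerSubgroup,
        (∀ σ : Field.absoluteGaloisGroup ℚ, A.conjH1 2 κ.kerSubgroup σ t - t ∈ signedSelmerInfty A κ 1) →
        ∀ w : HeightOneSpectrum (𝓞 ℚ), ((2 : ℕ) : 𝓞 ℚ) ∈ w.asIdeal →
        ∃ xw : discreteH1 (localSubgroup (⊤ : Subgroup (Field.absoluteGaloisGroup ℚ)) (w.adicCompletion ℚ))
            (localPoints A (w.adicCompletion ℚ)),
          (∃ k : ℕ, 2 ^ k • xw = 0) ∧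
          ∀ y : A.subgroupH1 2 (⊤ : Subgroup (Field.absoluteGaloisGroup ℚ)),
            A.localResOver 2 ⊤ (w.adicCompletion ℚ) y = xw →
            t - A.resOfLe 2 (le_top : κ.kerSubgroup ≤ ⊤) y ∈
              localKummerOverOfEmb A 2 κ.kerSubgroup (closureEmb (K := ℚ) (w.adicCompletion ℚ))
                (⨆ n, signedLocalPoints κ (w.adicCompletion ℚ) A 1 n))
    (hlow : KobayashiLowerDivisibility A 2 1)
    (hflat : ∀ [NeZero (A.conductorNorm ℤ)] (f : CuspForm (Gamma0 (A.conductorNorm ℤ)) 2),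
      IsNewformOf A f → ∀ (Lplus Lminus : IwasawaAlgebra 2), IsPollackPair f 2 Lplus Lminus →
        ∃ n : ℕ, IsUnit (PowerSeries.coeff n (kobayashiL 1 Lplus Lminus))) :
    (∀ (κ : ZpExtension ℚ 2) (γ : Field.absoluteGaloisGroup ℚ), κ.IsCyclotomic → κ.IsTopGenerator γ →
      ∀ D : SignedSelmerDualData A κ γ 1, Module.IsTorsion (IwasawaAlgebra 2) D.X ∧ D.mu = 0) ∧
    KobayashiMainConjecture A 2 1 := by
  have hSel : Finite (A.selmerGroupPInfty 2) := finite_selmerGroupPInfty_two_of_analyticRank_eq_zero A hGZK hr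
  have hEC := fun (κ : ZpExtension ℚ 2) (γ : Field.absoluteGaloisGroup ℚ) (hκ : κ.IsCyclotomic)
      (hγ : κ.IsTopGenerator γ) (hSel' : Finite (A.selmerGroupPInfty 2)) ↦
    signedEulerCharTwo_at_of_local A hss hκ hγ (hlev κ hκ) (hcyc κ hκ) (hlocK κ hκ) hC h412 hcork hP108 hWL hSel'
  have hT2 : ∀ (κ : ZpExtension ℚ 2) (γ : Field.absoluteGaloisGroup ℚ), κ.IsCyclotomic → κ.IsTopGenerator γ →
      ∀ D : SignedSelmerDualData A κ γ 1, Module.IsTorsion (IwasawaAlgebra 2) D.X :=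
    fun κ γ hκ hγ D ↦ (finiteTorsion_at_of_signedEulerCharTwo hEC hSel κ γ hκ hγ D).2
  obtain ⟨hMC, hnorm⟩ := signedMainConjectureCMTwo_at_rankZero_of_lowerDivisibility A hBF hmod hLrat hGZK hcm hss
    ha hr hT2 (kimControl_at_of_signedEulerCharTwo hEC) hlow
    (fun f hf ϖ hϖ Lplus Lminus hPP ↦ ⟨padicValRat_periodRatio_eq_zero_two A h2 hss hf hϖ, hflat f hf Lplus Lminus hPP⟩)
  refine ⟨fun κ γ hκ hγ D ↦ ⟨hT2 κ γ hκ hγ D, ?_⟩, hMC⟩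
  exact stub_generatorChangeCMTwo A hcm hr hss ha hT2 (fun κ₀ γ₀ hκ₀ hγ₀ hγ₀' D₀ ↦ (hnorm κ₀ γ₀ hκ₀ hγ₀ hγ₀' D₀).2)
    κ γ hκ hγ D

end Summit.BirchSwinnertonDyer.BirchSwinnertonDyer.Theorems

end
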